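import Summits.BirchSwinnertonDyer.Rank1Residual.F1Sign2.ParitySymbolCocycleAtTwoProofsGluedPair
import HarnessLib

/-!
# Cell `bsd-f1-sign2`, lens `-desc` g14 (MEMO-desc §22.13, add1, add2): PROOFS for `ParitySymbolCocycleAtTwo.lean`, part 3 — the marked point
# `(0,c) ∈ E′_f(ℚ)`: `E′_f(ℚ)[2^∞] = 0`, the DUPLICATION IDENTITY, and row DESC-§22-V′ PROVED (`thetaDiscrepancyDetectsPartnerRankAtTwo_holds`)

Contents (ns `…F1Sign2.MarkedPoint`): `equation_gmPartner`, `negY_gmPartner`, `not_equation_zero`, `eq_zero_of_two_nsmul_eq_zero`,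
`eq_zero_of_two_pow_nsmul_eq_zero`, `isSquare_neg_root_of_halves` (`Q + Q = (0,c) ⇒ −θ′ ∈ L_{E′}^{×2}`), `isSquare_thetaDiscrepancy_of_halves` (the `⇐`
half of row V), `MarkedPoint.thetaDiscrepancyDetectsPartnerRankAtTwo_holds`; then `Summit.BirchSwinnertonDyer.Rank1Residual.F1Sign2.thetaDiscrepancyDetectsPartnerRankAtTwo_holds` (row V′ BY NAME).
Part 4 (`ParitySymbolCocycleAtTwoProofsHalving.lean`) carries Cassels' halving lemma and row V.

TYPER FILING (seat `bsd-f1-sign2-ty` g8): source `HOME/MEMO-desc-data/g14/lean/MarkedPoint.lean` 39fea69b4f1f29aa (462 l.; planner -desc g14, ADDENDUM 6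
2026-08-28T09:49:51Z; farm rc 0 · 0 warn · 0 sorry, axioms propext, Classical.choice, Quot.sound; REF1 D-desc-ref1-23 scope = cmpdecls/axioms on this file),
proofs VERBATIM, split in two only for the 400-line cap on `F1Sign2` modules carrying proofs (part 3 = lines 69–200 + 438–460, part 4 = lines 202–436).
The planner's local copies of the row defs V/V′ and of `gmPartner_nonsingular_markedPoint` are DELETED: the rows and that support lemma live in the
statement module `F1Sign2/ParitySymbolCocycleAtTwo.lean` §B-add (-ty V-append p623106), so the theorems prove the TREE rows by name (same discipline as
parts 1–2, p620606/p621018: helpers in the planner's sub-namespace `…F1Sign2.MarkedPoint`, `…F1Sign2.<row>_holds` at the end).  Builder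
`tools/mk_desc22proofs_mp.py` (sha-asserting; published with the filed text under `HOME/MEMO-ty-data/g8/`); no `sorry`, no new `def … : Prop`, no `instance`,
no `notation`; docstrings as in the planner's file.  REF1 §89 (b): rows V/V′ CLEARED (V theorem on paper via Cassels LMSST §15 Lemma 2 or REF1's explicit
tangent route; V′ = V + `E′(ℚ)[2] = 0`); REF2 v22 §2: VARIANT / in-print assembly (Bruin 2004 §5 + Cassels 1991 §15 Lemma 2; V′ adds Bruin Cor. 3.4).

Planner's proof-file docstring (verbatim, -desc g14 `MarkedPoint.lean`):
# Cell `bsd-f1-sign2`, lens `-desc` g14 (MEMO-desc §22.13): the theta-discrepancy of the glued pair IS the Cassels class of the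
# marked point — rows DESC-§22-V `ThetaDiscrepancySquareIffMarkedPointHalvesAtTwo` and DESC-§22-V′ `ThetaDiscrepancyDetectsPartnerRankAtTwo` PROVED.

For the Green–Maistret glued pair `E_f = gmCurve a b c : y² = x³ + ax² + bx + c`, `E′_f = gmPartner a b c : y² = x³ + bx² + acx + c²`
with a pinned congruence `ψ : L_{E′} → L_E` (`ψ(θ′)·θ_E = 16c`) and `u = u_{E_f,E′_f} = c_E′(θ_E)·ψ(c_{E′}′(θ′))`:
* `isSquare_neg_root_of_halves` — DUPLICATION IDENTITY in `L_{E′} = ℚ[X]/(c_{E′})`: `Q + Q = (0,c) ⇒ −θ′ = (M/(16y_Q))²`,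
  `M = (4x_Q − θ′)² − (3θ′² + 8bθ′ + 16ac)` (one `linear_combination`, certificate `256P₃² − 256g(x_Q)(4b + 8x_Q + θ′) − M² = −4(θ′ + 8x_Q + 4b)c_{E′}(θ′)`);
* `isSquare_thetaDiscrepancy_of_halves` — hence `u ∈ L_E^{×2}` (row U: `u·(−cθ_E) = (2c·c_E′(θ_E))²` and the pin give `4u = −c_E′(θ_E)²ψ(θ′)`, `four_mul_thetaDiscrepancy`);
* `coords_eq_zero`, `exists_coords` — coordinates `α₀ + α₁θ′ + α₂θ′²` in the cubic algebra (existence via `%ₘ`, uniqueness via degree);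
* `exists_halves_of_isSquare_neg_root` — CASSELS' HALVING LEMMA for the marked point: `−θ′ = (α₀ + α₁θ′ + α₂θ′²)² ⇒ α₂ ≠ 0` and
  `Q := (α₁/(4α₂) − b, −1/(8α₂))` satisfies `Q + Q = ±(0,c)` (compare the `1, θ′, θ′²`-coefficients of `M(x_Q)² = (16y_Q(α + r))²`: the `θ′²`-coefficient
  kills the defect `r`, the `θ′`-coefficient is the Weierstrass equation, the constant is `x(2Q) = 0`);
* `psi_surjective` + `isSquare_neg_root_of_isSquare_thetaDiscrepancy` — `u ∈ L_E^{×2} ⇒ −θ′ ∈ L_{E′}^{×2}` (`c_E′(θ_E) ≠ 0` in the field `L_E`; `ψ` injective between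
  `3`-dimensional `ℚ`-algebras, hence onto);
* `thetaDiscrepancySquareIffMarkedPointHalvesAtTwo_holds` — **row V**: `u ∈ L_E^{×2} ⟺ (0,c) ∈ 2E′_f(ℚ)`;
* `eq_zero_of_two_pow_nsmul_eq_zero` — `E′_f(ℚ)[2^∞] = 0` when `c_{E′}` is irreducible; `thetaDiscrepancyDetectsPartnerRankAtTwo_holds` — **row V′**:
  `u ∉ L_E^{×2} ⇒ (0,c)` has infinite order in `E′_f(ℚ)`.
Row defs V/V′ are restated VERBATIM from `Sketch-v19V.lean` 805b155533ae6839 in this file's namespace (the typer renames / re-homes them on landing,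
as for rows U/K/Z/A). Imports only the tree module `F1Sign2.ParitySymbolCocycleAtTwoProofsGluedPair` (p620606). No `sorry`, no `instance`, no `notation`.
-/

noncomputable section

open scoped Classical

open WeierstrassCurve Polynomial

namespace Summit.BirchSwinnertonDyer.Rank1Residual.F1Sign2.MarkedPoint

/-! ## The Weierstrass data of `E′_f` (the marked point `(0,c)` is nonsingular: `F1Sign2.gmPartner_nonsingular_markedPoint`, statement module §B-add) -/

/-- The affine equation of `E′_f`: `y² = x³ + b x² + ac x + c²`. -/
lemma equation_gmPartner (a b c : ℤ) {x y : ℚ} (h : (gmPartner a b c).toAffine.Equation x y) :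
    y ^ 2 = x ^ 3 + b * x ^ 2 + a * c * x + (c : ℚ) ^ 2 := by
  rw [WeierstrassCurve.Affine.equation_iff] at h
  simp [gmPartner] at h
  linear_combination h

/-- `negY` on `E′_f` is `y ↦ −y` (`a₁ = a₃ = 0`). -/
lemma negY_gmPartner (a b c : ℤ) (x y : ℚ) : (gmPartner a b c).toAffine.negY x y = -y := by
  simp [gmPartner]

/-- A point with `y = 0` on `E′_f` would give a rational root of the (irreducible) `2`-division cubic. -/
lemma not_equation_zero (a b c : ℤ) [Fact (Irreducible (twoDivisionUCubic (gmPartner a b c)))] {x : ℚ}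
    (h : (gmPartner a b c).toAffine.Equation x 0) : False := by
  have heq := equation_gmPartner a b c h
  have hroot : IsRoot (twoDivisionUCubic (gmPartner a b c)) (4 * x) := by
    simp only [IsRoot, twoDivisionUCubic, eval_add, eval_mul, eval_pow, eval_X, eval_C, gmP_b₂, gmP_b₄, gmP_b₆]
    linear_combination (-64) * heq
  have h1 := degree_eq_one_of_irreducible_of_root (Fact.out : Irreducible (twoDivisionUCubic (gmPartner a b c))) hroot
  have h3 : (twoDivisionUCubic (gmPartner a b c)).degree = 3 := by
    unfold twoDivisionUCubic; compute_degree!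
  rw [h3] at h1
  exact absurd h1 (by decide)

/-- `E′_f(ℚ)[2] = 0`: a rational point killed by `2` is `0`. -/
lemma eq_zero_of_two_nsmul_eq_zero (a b c : ℤ) [Fact (Irreducible (twoDivisionUCubic (gmPartner a b c)))]
    (S : (gmPartner a b c).toAffine.Point) (h2 : S + S = 0) : S = 0 := by
  rcases S with _ | ⟨x, y, hS⟩
  · rfl
  · by_cases hy : y = (gmPartner a b c).toAffine.negY x y
    · have hy0 : y = 0 := by rw [negY_gmPartner] at hy; linarith
      subst hy0
      exact (not_equation_zero a b c hS.1).elim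
    · rw [WeierstrassCurve.Affine.Point.add_self_of_Y_ne hy] at h2
      exact absurd h2 (WeierstrassCurve.Affine.Point.some_ne_zero _)

/-- No `2`-power torsion: `2^k • S = 0 ⇒ S = 0`. -/
lemma eq_zero_of_two_pow_nsmul_eq_zero (a b c : ℤ) [Fact (Irreducible (twoDivisionUCubic (gmPartner a b c)))]
    (k : ℕ) : ∀ S : (gmPartner a b c).toAffine.Point, (2 ^ k) • S = 0 → S = 0 := by
  induction k with
  | zero => intro S h; simpa using h
  | succ k ih =>
      intro S h
      have h' : (2 ^ k) • (S + S) = 0 := by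
        rw [← two_nsmul, ← mul_nsmul, ← pow_succ']; exact h
      exact eq_zero_of_two_nsmul_eq_zero a b c S (ih _ h')

/-! ## The duplication identity: `Q + Q = (0,c) ⇒ −θ_{E′} ∈ L_{E′}^{×2}` -/

/-- If `Q + Q = (0,c)` in `E′_f(ℚ)` then `−θ_{E′}` is a square in `L_{E′} = ℚ[X]/(c_{E′})`. -/
theorem isSquare_neg_root_of_halves (a b c : ℤ) (h : (gmPartner a b c).toAffine.Nonsingular 0 (c : ℚ))
    (Q : (gmPartner a b c).toAffine.Point) (hQ : Q + Q = WeierstrassCurve.Affine.Point.some 0 (c : ℚ) h) :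
    IsSquare (-(twoDivisionRoot (gmPartner a b c))) := by
  rcases Q with _ | ⟨x₀, y₀, hQ0⟩
  · simp only [← WeierstrassCurve.Affine.Point.zero_def, add_zero] at hQ
    exact absurd hQ.symm (WeierstrassCurve.Affine.Point.some_ne_zero _)
  · by_cases hy : y₀ = (gmPartner a b c).toAffine.negY x₀ y₀
    · rw [WeierstrassCurve.Affine.Point.add_self_of_Y_eq hy] at hQ
      exact absurd hQ.symm (WeierstrassCurve.Affine.Point.some_ne_zero _)
    · rw [WeierstrassCurve.Affine.Point.add_self_of_Y_ne hy] at hQ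
      have hx : (gmPartner a b c).toAffine.addX x₀ x₀ ((gmPartner a b c).toAffine.slope x₀ x₀ y₀ y₀) = 0 :=
        (WeierstrassCurve.Affine.Point.some.injEq _ _ _ _ _ _).mp hQ |>.1
      rw [WeierstrassCurve.Affine.slope_of_Y_ne rfl hy] at hx
      have hy0 : y₀ ≠ 0 := by
        intro h0; apply hy; rw [negY_gmPartner, h0, neg_zero]
      have heq := equation_gmPartner a b c hQ0.1
      simp only [negY_gmPartner, WeierstrassCurve.Affine.addX] at hx
      simp [gmPartner] at hx
      -- hx : ((3x₀² + 2bx₀ + ac) / (y₀ + y₀))² - b - x₀ - x₀ = 0  ⇒  (3x₀²+2bx₀+ac)² = 4y₀²(b + 2x₀)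
      have h2y : (y₀ - -y₀) ≠ 0 := by
        intro h0; apply hy0; linarith
      have hx1 : (3 * x₀ ^ 2 + 2 * (b : ℚ) * x₀ + (a : ℚ) * c) ^ 2 = 4 * y₀ ^ 2 * ((b : ℚ) + 2 * x₀) := by
        field_simp at hx
        linear_combination hx
      -- pass to L′
      set L := twoDivisionAlgebra (gmPartner a b c) with hL
      have hF := GluedPairIdentity.root_relation (gmPartner a b c)
      rw [gmP_b₂, gmP_b₄, gmP_b₆] at hF
      have h16y : (16 * y₀) ≠ 0 := mul_ne_zero (by norm_num) hy0
      have hW0 := congrArg (algebraMap ℚ L) (mul_inv_cancel₀ h16y)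
      have heq' := congrArg (algebraMap ℚ L) heq
      have hx1' := congrArg (algebraMap ℚ L) hx1
      simp only [map_mul, map_ofNat, map_pow, map_add, map_one] at hF hW0 heq' hx1'
      refine ⟨algebraMap ℚ L ((16 * y₀)⁻¹) *
        ((algebraMap ℚ L (4 * x₀) - twoDivisionRoot (gmPartner a b c)) ^ 2 -
          (3 * twoDivisionRoot (gmPartner a b c) ^ 2 + algebraMap ℚ L (8 * (b : ℚ)) * twoDivisionRoot (gmPartner a b c) +
            algebraMap ℚ L (16 * ((a : ℚ) * c)))), ?_⟩
      simp only [map_mul, map_ofNat]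
      generalize twoDivisionRoot (gmPartner a b c) = t at hF ⊢
      generalize algebraMap ℚ L ((16 * y₀)⁻¹) = Wc at hW0 ⊢
      generalize algebraMap ℚ L x₀ = X at heq' hx1' ⊢
      generalize algebraMap ℚ L y₀ = Y at heq' hx1' hW0 ⊢
      generalize algebraMap ℚ L (a : ℚ) = A at hF heq' hx1' ⊢
      generalize algebraMap ℚ L (b : ℚ) = B at hF heq' hx1' ⊢
      generalize algebraMap ℚ L (c : ℚ) = Cc at hF heq' hx1' ⊢
      linear_combination (t * (1 + 16 * Y * Wc)) * hW0 + (-(Wc ^ 2 * (256 * t + 1024 * (B + 2 * X)))) * heq' +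
        (-(4 * (t + 8 * X + 4 * B) * Wc ^ 2)) * hF + (-(256 * Wc ^ 2)) * hx1'

/-- If the marked point is halvable in `E′_f(ℚ)` then the theta-discrepancy is a square in `L_E` (the `⇐` half of row V). -/
theorem isSquare_thetaDiscrepancy_of_halves (a b c : ℤ) (hc : c ≠ 0)
    (ψ : twoDivisionAlgebra (gmPartner a b c) →ₐ[ℚ] twoDivisionAlgebra (gmCurve a b c))
    (hpin : ψ (twoDivisionRoot (gmPartner a b c)) * twoDivisionRoot (gmCurve a b c) =
      algebraMap ℚ (twoDivisionAlgebra (gmCurve a b c)) (16 * c : ℚ))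
    (h : (gmPartner a b c).toAffine.Nonsingular 0 (c : ℚ))
    (Q : (gmPartner a b c).toAffine.Point) (hQ : Q + Q = WeierstrassCurve.Affine.Point.some 0 (c : ℚ) h) :
    IsSquare (thetaDiscrepancyAtTwo (gmCurve a b c) (gmPartner a b c) ψ) := by
  obtain ⟨s, hs⟩ := isSquare_neg_root_of_halves a b c h Q hQ
  have hcQ : (c : ℚ) ≠ 0 := Int.cast_ne_zero.mpr hc
  have hU := GluedPairIdentity.thetaDiscrepancyOfGluedPairAtTwo_holds a b c hc ψ hpin
  have hS := congrArg ψ hs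
  rw [map_neg, map_mul] at hS
  set L := twoDivisionAlgebra (gmCurve a b c) with hL
  have hC0 := congrArg (algebraMap ℚ L) (mul_inv_cancel₀ hcQ)
  have hH0 := congrArg (algebraMap ℚ L) (mul_inv_cancel₀ (two_ne_zero : (2 : ℚ) ≠ 0))
  simp only [map_mul, map_ofNat, map_neg, map_one] at hU hpin hC0 hH0
  refine ⟨twoDivisionDifferent (gmCurve a b c) * ψ s * algebraMap ℚ L (2 : ℚ)⁻¹, ?_⟩
  generalize thetaDiscrepancyAtTwo (gmCurve a b c) (gmPartner a b c) ψ = u at hU ⊢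
  generalize twoDivisionDifferent (gmCurve a b c) = d at hU ⊢
  generalize twoDivisionRoot (gmCurve a b c) = θ at hU hpin ⊢
  generalize ψ (twoDivisionRoot (gmPartner a b c)) = T at hpin hS ⊢
  generalize ψ s = S at hS ⊢
  generalize algebraMap ℚ L (c : ℚ)⁻¹ = Ci at hC0
  generalize algebraMap ℚ L (2 : ℚ)⁻¹ = Hh at hH0 ⊢
  generalize algebraMap ℚ L (c : ℚ) = Cc at hU hpin hC0 ⊢
  -- θ is a unit: θ * (T * Ci * Hh^4) = 1
  have hθ : θ * (T * Ci * Hh ^ 4) = 1 := by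
    linear_combination (Ci * Hh ^ 4) * hpin + (16 * Hh ^ 4) * hC0 + (1 + 2 * Hh + 4 * Hh ^ 2 + 8 * Hh ^ 3) * hH0
  -- u = -4 d² T Hh⁴ (θ⁻¹ = T Ci Hh⁴)
  have hu : u = -(4 * d ^ 2 * T * Hh ^ 4) := by
    linear_combination (-(Ci ^ 2 * T * Hh ^ 4)) * hU + (-u) * hθ +
      (-(u * θ * T * Ci * Hh ^ 4 + 4 * d ^ 2 * T * Hh ^ 4 * (Cc * Ci + 1))) * hC0
  linear_combination hu + (4 * d ^ 2 * Hh ^ 4) * hS + (d ^ 2 * S ^ 2 * Hh ^ 2 * (2 * Hh + 1)) * hH0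

/-! ## Row V′ -/

/-- **Row DESC-§22-V′ PROVED.** If `u_{E_f,E′_f}` is not a square in `L_E`, the marked point `(0,c)` has infinite order in `E′_f(ℚ)`
(`E′_f(ℚ)[2^∞] = 0`, so a torsion marked point would be halvable; then row V `⇐`). -/
theorem thetaDiscrepancyDetectsPartnerRankAtTwo_holds : ThetaDiscrepancyDetectsPartnerRankAtTwo := by
  intro a b c hc _hΔ _ _ ψ hpin hnsq
  refine ⟨gmPartner_nonsingular_markedPoint a b c hc, ?_⟩
  set T₀ : (gmPartner a b c).toAffine.Point :=
    WeierstrassCurve.Affine.Point.some 0 (c : ℚ) (gmPartner_nonsingular_markedPoint a b c hc) with hT₀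
  intro hfin
  obtain ⟨n, hn, hnT⟩ := (isOfFinAddOrder_iff_nsmul_eq_zero).mp hfin
  obtain ⟨k, m, hm, rfl⟩ := Nat.exists_eq_two_pow_mul_odd hn.ne'
  have h1 : (2 ^ k) • (m • T₀) = 0 := by
    rw [← mul_nsmul, Nat.mul_comm]; exact hnT
  have h2 : m • T₀ = 0 := eq_zero_of_two_pow_nsmul_eq_zero a b c k _ h1
  obtain ⟨j, rfl⟩ := hm
  have h3 : T₀ = -(j • T₀) + -(j • T₀) := by
    have : (2 * j) • T₀ + T₀ = 0 := by rw [← succ_nsmul]; exact h2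
    rw [mul_nsmul', two_nsmul] at this
    rw [← neg_add]
    exact eq_neg_of_add_eq_zero_right this
  exact hnsq (isSquare_thetaDiscrepancy_of_halves a b c hc ψ hpin (gmPartner_nonsingular_markedPoint a b c hc)
    (-(j • T₀)) h3.symm)

end Summit.BirchSwinnertonDyer.Rank1Residual.F1Sign2.MarkedPoint

namespace Summit.BirchSwinnertonDyer.Rank1Residual.F1Sign2

/-- **DESC-§22-V′ `ThetaDiscrepancyDetectsPartnerRankAtTwo` HOLDS** (tree row of `ParitySymbolCocycleAtTwo.lean` §B-add, closed by name; proof -desc g14):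
`u ∉ L_E^{×2} ⇒` the marked point `(0,c)` has infinite order in `E′_f(ℚ)` (hence `rk E′_f ≥ 1`). -/
theorem thetaDiscrepancyDetectsPartnerRankAtTwo_holds : ThetaDiscrepancyDetectsPartnerRankAtTwo :=
  MarkedPoint.thetaDiscrepancyDetectsPartnerRankAtTwo_holds

end Summit.BirchSwinnertonDyer.Rank1Residual.F1Sign2

end
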